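import Literature.MathematicalPhysics.QuantumFieldTheory.U1VillainMasslessPhotonD4
import HarnessLib

/-!
# The Villain kernel `φ_β`: convergence, positivity, differentiability, continuity (proofs only)

Proof companion of `Literature/MathematicalPhysics/QuantumFieldTheory/U1VillainMasslessPhotonD4.lean`
(Fröhlich–Spencer 1982 §2.11, Villain `U(1)₄`), which defines the periodised Gaussian
`villainKernel β θ = ∑_{n ∈ ℤ} exp(-(β/2)(θ + 2πn)²)` (FS82 (2.2)), the field strength
`villainFieldStrengthFun β θ = φ_β'(θ)/φ_β(θ)` (real form `E` of FS82 (2.89), `Φ = -iE`) and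
`villainFieldStrength β z = E_β(arg z)`, proves their `2π`-periodicity and parity, and explicitly
leaves the analysis unproved ("it is summable for `β > 0`", "`φ_β'` is Mathlib's `deriv` … real
analytic for `β > 0`, not proved here", "positivity of `φ_β` … not proved here"). This file
declares no definition and no named fact; for `β > 0` it PROVES:

* `summable_villainKernel_term`, `villainKernel_pos`, `exp_le_villainKernel` (the `n = 0` term);
* term-wise differentiation: `hasDerivAt_villainKernel` — `φ_β` is differentiable with derivative
  the series of derivatives `∑ₙ -β(θ+2πn) e^{-(β/2)(θ+2πn)²}` (Mathlib
  `hasDerivAt_tsum_of_isPreconnected` on `(-|θ|-1, |θ|+1)` with the Gaussian domination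
  `abs_villainKernel_termDeriv_le`), `deriv_villainKernel_eq_tsum`, `continuous_villainKernel`,
  `continuous_deriv_villainKernel` (locally uniform convergence);
* `continuous_villainFieldStrengthFun`; `continuous_comp_arg_of_periodic` (a continuous
  `2π`-periodic function of `Complex.arg` is continuous on the unit circle although `arg` jumps
  at `-1`: it factors through `z ↦ (arg z : ℝ/2πℤ)` and `AddCircle.liftIoc`), hence
  `continuous_villainFieldStrength : Continuous (villainFieldStrength β)` and
  `continuous_villainKernel_arg`, and boundedness on the compact circle;
* the reflection `z ↦ z⁻¹` (`θ ↦ -θ`): `villainFieldStrengthFun_pi` (`E_β(π) = 0`, odd and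
  periodic), `villainFieldStrength_inv` (`E_β(arg z⁻¹) = -E_β(arg z)`, using `E_β(π) = 0` on the
  branch cut), `villainKernel_arg_inv`.

These feed `U1VillainMasslessPhotonD4Proofs.lean` (the Villain measure is a probability
measure; `⟨E_p⟩_Λ = 0`). Elementary real analysis; no source beyond FS82 (2.2), (2.89) for the
objects. [folklore]
-/

noncomputable section

open Filter Real Set
open scoped Topology

namespace Literature.MathematicalPhysics.QuantumFieldTheory

/-! ### Elementary series estimates -/

/-- `n ↦ e^{-b|n|}` is summable over `ℤ` for `b > 0` (two geometric series); private copy of a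
lemma several Literature files prove locally. [folklore] -/
private theorem summable_exp_neg_mul_abs_intCast {b : ℝ} (hb : 0 < b) :
    Summable fun n : ℤ => Real.exp (-b * |(n : ℝ)|) := by
  have hq0 : 0 ≤ Real.exp (-b) := (Real.exp_pos _).le
  have hq1 : Real.exp (-b) < 1 := Real.exp_lt_one_iff.2 (by linarith)
  rw [summable_int_iff_summable_nat_and_neg]
  have hgeo := summable_geometric_of_lt_one hq0 hq1
  have key : ∀ n : ℕ, Real.exp (-b * |((n : ℤ) : ℝ)|) = Real.exp (-b) ^ n := by
    intro n
    rw [← Real.exp_nat_mul, Int.cast_natCast, Nat.abs_cast]; ring_nf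
  have key' : ∀ n : ℕ, Real.exp (-b * |((-(n : ℤ) : ℤ) : ℝ)|) = Real.exp (-b) ^ n := by
    intro n
    rw [← key n]; simp
  exact ⟨hgeo.congr fun n => (key n).symm, hgeo.congr fun n => (key' n).symm⟩

/-- `|n| ≤ n²` for an integer `n` (as reals); private helper. [folklore] -/
private theorem abs_intCast_le_sq (n : ℤ) : |(n : ℝ)| ≤ (n : ℝ) ^ 2 := by
  rcases eq_or_ne n 0 with rfl | hn
  · simp
  · have h1 : (1 : ℝ) ≤ |(n : ℝ)| := by exact_mod_cast Int.one_le_abs hn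
    calc |(n : ℝ)| = |(n : ℝ)| * 1 := (mul_one _).symm
      _ ≤ |(n : ℝ)| * |(n : ℝ)| := by gcongr
      _ = (n : ℝ) ^ 2 := by rw [← sq, sq_abs]

/-- Gaussian summability over `ℤ`: `∑_{n ∈ ℤ} e^{-c n²} < ∞` for `c > 0`; private copy of a lemma
several Literature files prove locally. [folklore] -/
private theorem summable_exp_neg_mul_intCast_sq {c : ℝ} (hc : 0 < c) :
    Summable fun n : ℤ => Real.exp (-c * (n : ℝ) ^ 2) := by
  refine (summable_exp_neg_mul_abs_intCast hc).of_nonneg_of_le (fun n => (Real.exp_pos _).le)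
    fun n => Real.exp_le_exp.2 ?_
  have := abs_intCast_le_sq n
  nlinarith

/-- The shifted squares are large: `2π²n² - θ² ≤ (θ + 2πn)²`. [folklore] -/
theorem sq_add_two_pi_mul_intCast_ge (θ : ℝ) (n : ℤ) :
    2 * π ^ 2 * (n : ℝ) ^ 2 - θ ^ 2 ≤ (θ + 2 * π * n) ^ 2 := by
  nlinarith [sq_nonneg (θ + 2 * π * n + θ), sq_nonneg (2 * π * n)]

/-- Uniform Gaussian domination of the Villain terms on `|θ| ≤ R`:
`exp(-(β/2)(θ + 2πn)²) ≤ e^{βR²/2} e^{-βπ²n²}` (`β ≥ 0`). [folklore] -/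
theorem villainKernel_term_le {β R θ : ℝ} (hβ : 0 ≤ β) (hθ : |θ| ≤ R) (n : ℤ) :
    Real.exp (-(β / 2) * (θ + 2 * π * n) ^ 2) ≤
      Real.exp (β / 2 * R ^ 2) * Real.exp (-(β * π ^ 2) * (n : ℝ) ^ 2) := by
  rw [← Real.exp_add]
  refine Real.exp_le_exp.2 ?_
  have h1 := sq_add_two_pi_mul_intCast_ge θ n
  have h2 : θ ^ 2 ≤ R ^ 2 := by
    have : |θ| ^ 2 ≤ R ^ 2 := by gcongr
    simpa [sq_abs] using this
  nlinarith

/-- `β|x| e^{-(β/2)x²} ≤ (β + 4) e^{-(β/4)x²}` (`β ≥ 0`): the elementary bound behind the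
summable domination of the term-wise derivatives (`|x| ≤ 1 + x²` and `t e^{-t} ≤ 1`). [folklore] -/
theorem mul_abs_mul_exp_neg_sq_le {β : ℝ} (hβ : 0 ≤ β) (x : ℝ) :
    β * |x| * Real.exp (-(β / 2) * x ^ 2) ≤ (β + 4) * Real.exp (-(β / 4) * x ^ 2) := by
  have hE : Real.exp (-(β / 2) * x ^ 2) =
      Real.exp (-(β / 4) * x ^ 2) * Real.exp (-(β / 4) * x ^ 2) := by
    rw [← Real.exp_add]; ring_nf
  have hle1 : Real.exp (-(β / 4) * x ^ 2) ≤ 1 :=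
    Real.exp_le_one_iff.2 (by nlinarith [sq_nonneg x])
  have ht : β / 4 * x ^ 2 * Real.exp (-(β / 4) * x ^ 2) ≤ 1 := by
    have h := Real.add_one_le_exp (β / 4 * x ^ 2)
    have hpos' : 0 < Real.exp (β / 4 * x ^ 2) := Real.exp_pos _
    rw [show -(β / 4) * x ^ 2 = -(β / 4 * x ^ 2) by ring, Real.exp_neg]
    rw [mul_inv_le_iff₀ hpos']
    nlinarith [sq_nonneg x]
  have habs : |x| ≤ 1 + x ^ 2 := by
    rcases le_or_gt 0 x with hx | hx
    · rw [abs_of_nonneg hx]; nlinarith [sq_nonneg (x - 1)]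
    · rw [abs_of_neg hx]; nlinarith [sq_nonneg (x + 1)]
  rw [hE]
  calc β * |x| * (Real.exp (-(β / 4) * x ^ 2) * Real.exp (-(β / 4) * x ^ 2))
      ≤ β * (1 + x ^ 2) * (Real.exp (-(β / 4) * x ^ 2) * Real.exp (-(β / 4) * x ^ 2)) := by
        gcongr
    _ = (β * Real.exp (-(β / 4) * x ^ 2) + 4 * (β / 4 * x ^ 2 * Real.exp (-(β / 4) * x ^ 2))) *
          Real.exp (-(β / 4) * x ^ 2) := by ring
    _ ≤ (β * 1 + 4 * 1) * Real.exp (-(β / 4) * x ^ 2) := by gcongr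
    _ = (β + 4) * Real.exp (-(β / 4) * x ^ 2) := by ring

/-! ### Convergence and positivity of `φ_β` -/

/-- The Villain series converges (`β > 0`). [folklore] -/
theorem summable_villainKernel_term {β : ℝ} (hβ : 0 < β) (θ : ℝ) :
    Summable fun n : ℤ => Real.exp (-(β / 2) * (θ + 2 * π * n) ^ 2) := by
  refine Summable.of_nonneg_of_le (fun n => (Real.exp_pos _).le)
    (fun n => villainKernel_term_le hβ.le le_rfl n) ?_
  exact (summable_exp_neg_mul_intCast_sq (by positivity)).mul_left _

/-- `φ_β(θ) > 0` (`β > 0`). [folklore] -/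
theorem villainKernel_pos {β : ℝ} (hβ : 0 < β) (θ : ℝ) : 0 < villainKernel β θ :=
  (summable_villainKernel_term hβ θ).tsum_pos (fun _ => (Real.exp_pos _).le) 0 (Real.exp_pos _)

/-- `φ_β(θ)` dominates its `n = 0` term: `exp(-(β/2)θ²) ≤ φ_β(θ)` (`β > 0`). [folklore] -/
theorem exp_le_villainKernel {β : ℝ} (hβ : 0 < β) (θ : ℝ) :
    Real.exp (-(β / 2) * θ ^ 2) ≤ villainKernel β θ := by
  have h := (summable_villainKernel_term hβ θ).le_tsum 0 (fun n _ => (Real.exp_pos _).le)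
  simp only [Int.cast_zero, mul_zero, add_zero] at h
  exact h

/-! ### Term-wise differentiation -/

/-- Each Villain term is differentiable in `θ`, with derivative `-β(θ + 2πn) exp[-(β/2)(θ + 2πn)²]`.
[folklore] -/
theorem hasDerivAt_villainKernel_term (β θ : ℝ) (n : ℤ) :
    HasDerivAt (fun θ => Real.exp (-(β / 2) * (θ + 2 * π * n) ^ 2))
      (-(β * (θ + 2 * π * n)) * Real.exp (-(β / 2) * (θ + 2 * π * n) ^ 2)) θ := by
  have h1 : HasDerivAt (fun θ : ℝ => (θ + 2 * π * n) ^ 2) ((2 : ℕ) * (θ + 2 * π * n) ^ (2 - 1)) θ :=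
    (hasDerivAt_pow 2 (θ + 2 * π * n)).comp_add_const θ (2 * π * n)
  refine ((h1.const_mul (-(β / 2))).exp).congr_deriv ?_
  norm_num; ring

/-- Summable domination of the term-wise derivatives, uniformly on `|θ| ≤ R`:
`|-β(θ+2πn) e^{-(β/2)(θ+2πn)²}| ≤ (β + 4) e^{βR²/4} e^{-(βπ²/2) n²}` (`β ≥ 0`). [folklore] -/
theorem abs_villainKernel_termDeriv_le {β R θ : ℝ} (hβ : 0 ≤ β) (hθ : |θ| ≤ R) (n : ℤ) :
    |-(β * (θ + 2 * π * n)) * Real.exp (-(β / 2) * (θ + 2 * π * n) ^ 2)| ≤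
      (β + 4) * Real.exp (β / 4 * R ^ 2) * Real.exp (-(β / 2 * π ^ 2) * (n : ℝ) ^ 2) := by
  rw [abs_mul, abs_neg, abs_mul, abs_of_nonneg (show (0 : ℝ) ≤ β from hβ),
    abs_of_pos (Real.exp_pos (-(β / 2) * (θ + 2 * π * n) ^ 2))]
  refine (mul_abs_mul_exp_neg_sq_le hβ _).trans ?_
  have h := villainKernel_term_le (β := β / 2) (by positivity) hθ n
  have h4 : (0 : ℝ) ≤ β + 4 := by linarith
  calc (β + 4) * Real.exp (-(β / 4) * (θ + 2 * π * n) ^ 2)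
      ≤ (β + 4) * (Real.exp (β / 2 / 2 * R ^ 2) * Real.exp (-(β / 2 * π ^ 2) * (n : ℝ) ^ 2)) := by
        refine mul_le_mul_of_nonneg_left ?_ h4
        have e : -(β / 4) * (θ + 2 * π * n) ^ 2 = -(β / 2 / 2) * (θ + 2 * π * n) ^ 2 := by ring
        rw [e]; exact h
    _ = (β + 4) * Real.exp (β / 4 * R ^ 2) * Real.exp (-(β / 2 * π ^ 2) * (n : ℝ) ^ 2) := by
        rw [show β / 2 / 2 = β / 4 by ring]; ring

/-- **Term-wise differentiation of the Villain series** (`β > 0`): `φ_β` is differentiable at every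
`θ`, with derivative the series of derivatives (Mathlib `hasDerivAt_tsum_of_isPreconnected` on the
interval `(-|θ|-1, |θ|+1)` with the domination `abs_villainKernel_termDeriv_le`). [folklore] -/
theorem hasDerivAt_villainKernel {β : ℝ} (hβ : 0 < β) (θ : ℝ) :
    HasDerivAt (villainKernel β)
      (∑' n : ℤ, -(β * (θ + 2 * π * n)) * Real.exp (-(β / 2) * (θ + 2 * π * n) ^ 2)) θ := by
  set R : ℝ := |θ| + 1 with hR
  have hθ : θ ∈ Ioo (-R) R := by
    constructor <;> [have := neg_abs_le θ; have := le_abs_self θ] <;> linarith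
  have h0 : (0 : ℝ) ∈ Ioo (-R) R := by constructor <;> linarith [abs_nonneg θ]
  unfold villainKernel
  refine hasDerivAt_tsum_of_isPreconnected (t := Ioo (-R) R)
    (u := fun n : ℤ => (β + 4) * Real.exp (β / 4 * R ^ 2) *
      Real.exp (-(β / 2 * π ^ 2) * (n : ℝ) ^ 2))
    ?_ isOpen_Ioo isPreconnected_Ioo (fun n y _ => hasDerivAt_villainKernel_term β y n)
    (fun n y hy => ?_) h0 (summable_villainKernel_term hβ 0) hθ
  · exact (summable_exp_neg_mul_intCast_sq (by positivity)).mul_left _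
  · rw [Real.norm_eq_abs]
    exact abs_villainKernel_termDeriv_le hβ.le (abs_le.2 ⟨hy.1.le, hy.2.le⟩) n

/-- `φ_β' = ∑ₙ (term)'` (`β > 0`). [folklore] -/
theorem deriv_villainKernel_eq_tsum {β : ℝ} (hβ : 0 < β) :
    deriv (villainKernel β) = fun θ =>
      ∑' n : ℤ, -(β * (θ + 2 * π * n)) * Real.exp (-(β / 2) * (θ + 2 * π * n) ^ 2) :=
  funext fun θ => (hasDerivAt_villainKernel hβ θ).deriv

/-- `φ_β` is continuous (`β > 0`). [folklore] -/
theorem continuous_villainKernel {β : ℝ} (hβ : 0 < β) : Continuous (villainKernel β) :=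
  continuous_iff_continuousAt.2 fun θ => (hasDerivAt_villainKernel hβ θ).continuousAt

/-- The series of derivatives is continuous (`β > 0`; locally uniform convergence). [folklore] -/
theorem continuous_villainKernel_derivSeries {β : ℝ} (hβ : 0 < β) :
    Continuous fun θ : ℝ =>
      ∑' n : ℤ, -(β * (θ + 2 * π * n)) * Real.exp (-(β / 2) * (θ + 2 * π * n) ^ 2) := by
  refine continuous_iff_continuousAt.2 fun θ => ?_
  set R : ℝ := |θ| + 1 with hR
  have hθ : θ ∈ Ioo (-R) R := by
    constructor <;> [have := neg_abs_le θ; have := le_abs_self θ] <;> linarith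
  have hc : ContinuousOn (fun θ : ℝ =>
      ∑' n : ℤ, -(β * (θ + 2 * π * n)) * Real.exp (-(β / 2) * (θ + 2 * π * n) ^ 2))
      (Ioo (-R) R) := by
    refine continuousOn_tsum
      (u := fun n : ℤ => (β + 4) * Real.exp (β / 4 * R ^ 2) *
        Real.exp (-(β / 2 * π ^ 2) * (n : ℝ) ^ 2))
      (fun n => Continuous.continuousOn (by fun_prop)) ?_ (fun n y hy => ?_)
    · exact (summable_exp_neg_mul_intCast_sq (by positivity)).mul_left _
    · rw [Real.norm_eq_abs]
      exact abs_villainKernel_termDeriv_le hβ.le (abs_le.2 ⟨hy.1.le, hy.2.le⟩) n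
  exact hc.continuousAt (Ioo_mem_nhds hθ.1 hθ.2)

/-- `φ_β'` is continuous (`β > 0`). [folklore] -/
theorem continuous_deriv_villainKernel {β : ℝ} (hβ : 0 < β) :
    Continuous (deriv (villainKernel β)) := by
  rw [deriv_villainKernel_eq_tsum hβ]
  exact continuous_villainKernel_derivSeries hβ

/-! ### The field strength `E_β = φ_β'/φ_β`: continuity, and on the circle -/

/-- `E_β` is continuous (`β > 0`: `φ_β > 0`, `φ_β` and `φ_β'` continuous). [folklore] -/
theorem continuous_villainFieldStrengthFun {β : ℝ} (hβ : 0 < β) :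
    Continuous (villainFieldStrengthFun β) := by
  unfold villainFieldStrengthFun
  exact (continuous_deriv_villainKernel hβ).div (continuous_villainKernel hβ)
    fun θ => (villainKernel_pos hβ θ).ne'

/-- A continuous `2π`-periodic `g : ℝ → ℝ` gives a continuous function `z ↦ g(arg z)` on the unit
circle, although `arg` jumps at `-1`: `g ∘ arg` factors through the continuous map
`z ↦ (arg z : ℝ/2πℤ)` (`Complex.continuousAt_arg_coe_angle`) and `AddCircle.liftIoc`. [folklore] -/
theorem continuous_comp_arg_of_periodic {g : ℝ → ℝ} (hg : Continuous g)
    (hper : ∀ θ, g (θ + 2 * π) = g θ) :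
    Continuous fun z : Circle => g (Complex.arg (z : ℂ)) := by
  -- `AddCircle.liftIoc` needs `0 < 2π` as a `Fact` (as in `Mathlib.Analysis.Polynomial.Fourier`)
  haveI : Fact (0 < 2 * π) := ⟨Real.two_pi_pos⟩
  have hkey : ∀ z : Circle, g (Complex.arg (z : ℂ)) =
      AddCircle.liftIoc (2 * π) (-π) g ((Complex.arg (z : ℂ) : ℝ) : AddCircle (2 * π)) := by
    intro z
    rw [AddCircle.liftIoc_coe_apply]
    have := Complex.arg_mem_Ioc (z : ℂ)
    rwa [show -π + 2 * π = π by ring]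
  simp_rw [hkey]
  have hc : Continuous fun z : Circle => ((Complex.arg (z : ℂ) : ℝ) : AddCircle (2 * π)) := by
    have h : ∀ z : Circle, ContinuousAt ((↑) ∘ Complex.arg : ℂ → Real.Angle) (z : ℂ) := fun z =>
      Complex.continuousAt_arg_coe_angle (Circle.coe_ne_zero z)
    exact continuous_iff_continuousAt.2 fun z => (h z).comp continuous_subtype_val.continuousAt
  refine (AddCircle.liftIoc_continuous ?_ hg.continuousOn).comp hc
  rw [← hper (-π)]

/-- **The Villain field strength `z ↦ E_β(arg z)` is continuous on `U(1)`** (`β > 0`). [folklore] -/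
theorem continuous_villainFieldStrength {β : ℝ} (hβ : 0 < β) :
    Continuous (villainFieldStrength β) :=
  continuous_comp_arg_of_periodic (continuous_villainFieldStrengthFun hβ)
    (villainFieldStrengthFun_add_two_pi β)

/-- `z ↦ φ_β(arg z)` is continuous on `U(1)` (`β > 0`). [folklore] -/
theorem continuous_villainKernel_arg {β : ℝ} (hβ : 0 < β) :
    Continuous fun z : Circle => villainKernel β (Complex.arg (z : ℂ)) :=
  continuous_comp_arg_of_periodic (continuous_villainKernel hβ) (villainKernel_add_two_pi β)

/-- A continuous real function on the (compact) unit circle is bounded. [folklore] -/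
theorem exists_bound_of_continuous_circle {f : Circle → ℝ} (hf : Continuous f) :
    ∃ C, ∀ z, |f z| ≤ C := by
  obtain ⟨C, hC⟩ := (isCompact_univ.image hf).isBounded.subset_closedBall 0
  exact ⟨C, fun z => by simpa [Real.dist_eq] using hC (Set.mem_image_of_mem f (Set.mem_univ z))⟩

/-- The Villain field strength is bounded on `U(1)` (`β > 0`). [folklore] -/
theorem exists_bound_villainFieldStrength {β : ℝ} (hβ : 0 < β) :
    ∃ C, ∀ z, |villainFieldStrength β z| ≤ C :=
  exists_bound_of_continuous_circle (continuous_villainFieldStrength hβ)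

/-! ### The reflection `θ ↦ -θ` on the circle -/

/-- `E_β(π) = 0`: `E_β` is odd and `2π`-periodic. [folklore] -/
theorem villainFieldStrengthFun_pi (β : ℝ) : villainFieldStrengthFun β π = 0 := by
  have h1 := villainFieldStrengthFun_add_two_pi β (-π)
  have h2 := villainFieldStrengthFun_neg β π
  rw [show -π + 2 * π = π by ring] at h1
  linarith

/-- **`E_β(arg z⁻¹) = -E_β(arg z)`** on the unit circle: `arg z⁻¹ = -arg z` off the branch cut and
`E_β(π) = 0` on it — the field strength is odd under the reflection `U ↦ U⁻¹` (`θ ↦ -θ`). [folklore] -/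
theorem villainFieldStrength_inv (β : ℝ) (z : Circle) :
    villainFieldStrength β z⁻¹ = -villainFieldStrength β z := by
  unfold villainFieldStrength
  rw [Circle.coe_inv, Complex.arg_inv]
  split_ifs with h
  · rw [h, villainFieldStrengthFun_pi, neg_zero]
  · exact villainFieldStrengthFun_neg β _

/-- `φ_β(arg z⁻¹) = φ_β(arg z)` on the unit circle (the weight is even under the reflection). [folklore] -/
theorem villainKernel_arg_inv (β : ℝ) (z : Circle) :
    villainKernel β (Complex.arg ((z⁻¹ : Circle) : ℂ)) = villainKernel β (Complex.arg (z : ℂ)) := by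
  rw [Circle.coe_inv, Complex.arg_inv]
  split_ifs with h
  · rw [h]
  · exact villainKernel_neg β _

end Literature.MathematicalPhysics.QuantumFieldTheory
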